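import Summits.RiemannHypothesis.RiemannHypothesis.Theses.JensenPolynomials
import Summits.RiemannHypothesis.RiemannHypothesis.Theorems.JensenPolynomialsFarGumbelDefs
import Summits.RiemannHypothesis.RiemannHypothesis.Theorems.JensenPolynomialsFarGumbelFarMode
import Summits.RiemannHypothesis.RiemannHypothesis.Theorems.JensenPolynomialsFarGumbelElementary
import Summits.RiemannHypothesis.RiemannHypothesis.Theorems.JensenPolynomialsFarGumbelCubicTransferXi
import Summits.RiemannHypothesis.RiemannHypothesis.Theorems.JensenPolynomialsFarGumbelIntegralRepr
import Summits.RiemannHypothesis.RiemannHypothesis.Theorems.JensenPolynomialsFarGumbelCloserV3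
import Summits.RiemannHypothesis.RiemannHypothesis.Theorems.JensenPolynomialsFarGumbelXi0Box
import Summits.RiemannHypothesis.RiemannHypothesis.Theorems.JensenPolynomialsFarGumbelCurvature
import Summits.RiemannHypothesis.RiemannHypothesis.Theorems.JensenPolynomialsFarGumbelValueClose
import Summits.RiemannHypothesis.RiemannHypothesis.Theorems.JensenPolynomialsFarGumbelWantedConnector
import Summits.RiemannHypothesis.RiemannHypothesis.Theorems.JensenPolynomialsFarGumbelDescent
import Summits.RiemannHypothesis.RiemannHypothesis.Theorems.JensenPolynomialsFarGumbelJunk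

/-! # FINAL ASSEMBLY of crux `XiWindowZeroFreeRelFar` (stmt-RiemannHypothesis-19465): theory g8's registered skeleton
«far-gumbel» v5 (sha16 9e01753bc3c8d2f9) with ALL SIX STUBS taken from the tree — S0 `stub_farMode` p444719 (eng-2 g2),
S1 `stub_integralRepr` p452367 (eng-4 g3; content theory g7 / p440252), S2 `stub_junk` p463631 (eng g5), S3 `stub_laplaceFar`
(below: eng-4 g3's `laplaceFar_of_wanted_v3` p454068 on the six WANTED theorems of eng-2 g3 / eng-4 g3 / eng-5 g4 / prover g5),
S4 `stub_elementary` p448085 (eng-5 g3), S5 `stub_cubicTransfer` p449503 (eng-2 g2); composition `xiWindowZeroFreeRelFar_of_stubs`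
and closer `XiWindowZeroFreeRelFar_of` VERBATIM from the skeleton (kernel-checked real arithmetic). Filed by eng-4 g3 per theory g8's
ASSEMBLY.md; assembly check no. 9 (eng-5 g4, 19:36Z) and dry-run no. 8 (eng-4 g3) agree. 0 sorries. RH-FREE: an explicit estimate for
the window EGF of `ξ`'s Taylor data far out (`M ≥ 2·10¹⁸`); WHAT THIS IS NOT: nothing here bears on the zeros of `ζ` or the truth of RH.

ORIGINAL LINE CARD (theory g8):

# Line `far-gumbel` for the crux `XiWindowZeroFreeRelFar` (stmt-RiemannHypothesis-19465 = B1-rel far, `M ≥ 2·10¹⁸`; RH-FREE)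

v5 = v4 with S2 `stub_junk` REPAIRED (slack factor `e^{−M/10}` dropped; eng g5 13:25Z) and the two LANDED stubs S0 `stub_farMode` (p444719)
and S4 `stub_elementary` (p448085) no longer declared here but IMPORTED from the tree and cited by name (4 registered stubs remain: S1 S2 S3 S5); v4 = v3 with the objects moved to the tree
(`Theorems/JensenPolynomialsFarGumbelDefs.lean`, p445603).

THEORY g8 (2026-08-26).  THE FAR NORMAL FORM.  Write the window EGF polynomial of `ξ` as the kernel integral
`μ_{2M}·F_M(s) = I(M,s) = ∫₀^∞ Φ(u) u^{2M} T_M(a/u²) du`, `a = s·c_M/(M−½)`, `c_M = μ_{2M}/μ_{2M−2}` (`stub_integralRepr`,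
PROVED by theory g7, HOME `rh-jensen-theory/g7/lines/IntegralRepr.lean`).  Far out (`M ≥ 2·10¹⁸`) the tilted law
`Φ(u)u^{2M}` sits at the FAR MODE `υ` (`4πe^{4υ}υ = 2M + 9υ`, `υ(2·10¹⁸) = 9.512`, `ε := 1/υ ≤ 0.106`) where
`Φ = 2π²e^{9u}e^{−πe^{4u}}(1 + O(e^{−3πe^{4u}}))`, and in the GUMBEL VARIABLE `ξ = 4(u − υ)` the phase per unit
`Λ := πe^{4υ} = M/(2υ) + 9/4 ≈ 1.05·10¹⁷` is EXACTLY
  `f(ξ; w, ε) = (2/ε)·Log(1 + w(εξ/2 + ε²ξ²/16)) − e^{ξ}`,   `w = 1/(1+z̃)`, `z̃ = a/υ²` (`|z̃| ≤ 0.3502` on the B1 disc),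
whose `ε = 0` limit `wξ − e^{ξ}` is the Gamma/Gumbel phase (`∫ e^{Λ(wξ−e^ξ)}dξ = Γ(Λw)Λ^{−Λw} ≠ 0`): ONE saddle
`ξ_s = Log w + O(ε)`, `|Im ξ_s| ≤ 0.36` (so the contour `Im u = Im ξ_s/4` stays in `|Im u| ≤ 0.09 < π/8`, where `Φ_C` is
analytic, p424868), exact descent `Re e^{ξ_s}(1 + t − e^t) ≤ 0` along the horizontal line, and a CLOSED-FORM critical value
  `H(w,ε) = f(ξ_s) = H₀(w) + εH₁(w) + O(ε²)`,  `H₀ = w Log w − w` (`+1` at `w = 1`),  `H₁ = (w/8 − w²/4)(Log w)²`,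
`|H − H₀ − εH₁| ≤ 0.058ε²` on `|z̃| ≤ 0.36` (numerics `calc/fargumbel.out`; this two-parameter model reproduces the CERTIFIED
window data: `δ = 0.94880/0.90295/0.74482` at `M = 2·10¹⁸/10¹⁰/10⁴` vs eng-5/eng `0.9488/0.9029070/0.74498`, `q = 28.787/26.023/
17.395` vs `28.786/26.020/17.397`).  Hence `log|F_M(s)| = (M−½)log|1+z̃| + Λ·Re[H(w,ε) − H(1,ε)] + O(1)` and, `P₃ = T₃ log F_M`
being the cubic Taylor part, `log|F_M e^{−P₃}| = (M−½)·Re tail₄[Log(1+z̃) + (ε/2)(H₀+1+εH₁)] + O(Λε²) + O(1)`, whose sup on the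
disc is `0.004634·(M−½)` (at `ε → 0`, `arg z̃ ≈ 139°`; `0.0036·M` at the pin) against the allowance `(2/3)θ⁴δ²M ≥ M/118`
(`δ ≥ 0.9204` suffices; true `δ = 0.9488`): ROOM ×1.9–2.5, every junk term (small-`u` regions, binomial truncation, `Φ_{n≥2}`)
being `≤ e^{−M/10}` relative.  The cubic `P₃(s)` of `ξ` is identified with the closed-form cubic `(M−½)(z̃ + c₂z̃² + c₃z̃³)`,
`c₂ = −1/2 + ε/4 − ε²/16`, `c₃ = 1/3 − 5ε/12 + ε²/4`, through the FAR WINDOW LAWS `c_M = υ²(1 + O(10⁻¹⁷))`,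
`2MΔ² = 1 − ε/2 + ε²/8 + O(ε³)`, `(M−½)²ũ₃ = 2 − 5ε/2 + 3ε²/2 + O(ε³)` (two-sided, shared with the Stein-moment line of 19466).

STUBS (6; sorries only inside `stub_*`): `stub_farMode` (S, IVT) · `stub_integralRepr` (PROVED, g7) · `stub_junk` (M, three-region
truncation bookkeeping, contour-free) · `stub_laplaceFar` (L, THE HARD ONE: far steepest descent in the Gumbel variable with the
explicit approximate saddle `ξ₀ = Log w(1+ε(1/4−w/2))`, allowance `Λε³ + 6`, v3 cut after eng-4 g3's design point) ·
`stub_elementary` (M, two explicit inequalities on `|z̃| ≤ 0.3502`, allowance `1/150`) · `stub_cubicTransfer` (M, far window laws ⇒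
`|farCubic − Re P₃| ≤ M/1200` and allowance `≥ M/118`).  COMPOSITION `xiWindowZeroFreeRelFar_of_stubs` / `XiWindowZeroFreeRelFar_of`:
kernel-checked real arithmetic (`‖I−J‖ ≤ e^{−2}‖J‖` ⇒ `I ≠ 0`; `log|F_M e^{−P₃}| ≤ [farMain(z̃) − farMain(0)] + 2B + 2 − Re P₃ ≤
(M−½)/150 + 1 + M/1200 + 2(Λε³ + 6) + 2 ≤ 0.0076255·M + 15.01 ≤ M/118 ≤ A`; v3 BUDGET: S3 ×470, S4 ×1.44, S5 ×1.5 and `δ`-slack 3 %).  Why it dodges the stuck point of g7's generic steepest-descent line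
(`stub_uniformDescent`, XL, uniform in `M ≥ 10⁴`, saddle found numerically per `(M, φ)`): far out the saddle, the descent
direction and the critical value are CLOSED FORMS of `(w, ε)`; nothing is located numerically, and `ε²`-remainders carry `×10` room.
Nothing here bears on the truth of RH.
-/

noncomputable section
-- D-0017: `Summit.RiemannHypothesis.RiemannHypothesis.…` duplicates the namespace BY DESIGN (single-problem summit).
set_option linter.dupNamespace false

namespace Summit.RiemannHypothesis.RiemannHypothesis.Cruxes.XiWindowZeroFreeRelFar.FarGumbel

open Summit.RiemannHypothesis.RiemannHypothesis.Theorems.JensenPolynomials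
open Summit.RiemannHypothesis.RiemannHypothesis.Theorems.JensenPolynomials.FarGumbel
open Literature.NumberTheory.LFunctions MeasureTheory Complex Metric
open scoped Real

/-! ## The objects

v4 (2026-08-26): the twelve objects `cM winI farA farLam winJ farL0 farW farF farXi0 farMain farEnv farCubic` of v3
(sha16 `69a41b651df70375`) now live VERBATIM in the tree file `Theorems/JensenPolynomialsFarGumbelDefs.lean` (eng-4 g3, p445603,
commit 351eac2c0e86; namespace `…Theorems.JensenPolynomials.FarGumbel`, opened above) so that every stub theorem and this skeleton
elaborate against ONE copy; the stub NAMES and SIGNATURE TEXT below are those of v3 except S2 `stub_junk` (v5: factor `e^{−M/10}` dropped). -/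

/-! ## The stubs -/

-- `stub_farMode`: PROVED in the tree (p444719 `Theorems/JensenPolynomialsFarGumbelFarMode.lean`, eng-2 g2, namespace `…Theorems.JensenPolynomials.FarGumbel`, imported above) — the composition cites it by name.

-- `stub_junk`: PROVED in the tree (p463631 `Theorems/JensenPolynomialsFarGumbelJunk.lean`, eng g5, namespace `…Theorems.JensenPolynomials.FarGumbel`, imported above) — the composition cites it by name.

-- `stub_integralRepr`: PROVED in the tree (p452367 `Theorems/JensenPolynomialsFarGumbelIntegralRepr.lean`, eng-4 g3, namespace `…Theorems.JensenPolynomials.FarGumbel`, imported above) — the composition cites it by name.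


/-! ### S3 `stub_laplaceFar` = eng-4 g3's closer `laplaceFar_of_wanted_v3` (p454068) applied to the six landed WANTED theorems
(L0) `wanted_xi0_box` p456425 (eng-2 g3) · (L1) `wanted_saddle` p459161 (eng-4 g3) · (L2) `wanted_curvature` p456150 (eng-4 g3) ·
(L3) `wanted_descent` p464205 (eng-5 g4; one-variable facts p459455 eng-2 g3) · (L4) `wanted_connector` p459508 (prover g5) ·
(L5) `wanted_value` p459286 (eng-4 g3 over eng-2 g3's p458119) — all in namespace `…Theorems.JensenPolynomials.FarGumbel`. -/

/-- **stub S3 `stub_laplaceFar` (registered v5 text)**: eng-4 g3's `laplaceFar_of_wanted_v3` (p454068) on the six landed WANTED theorems. -/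
theorem stub_laplaceFar : ∀ M : ℕ, 2 * 10 ^ 18 ≤ M → ∀ υ : ℝ,
      ((189 / 20 : ℝ) ≤ υ ∧ 4 * Real.pi * Real.exp (4 * υ) * υ = 2 * (M : ℝ) + 9 * υ) →
      ∀ a : ℂ, ‖a‖ ≤ (9 / 25 : ℝ) * υ ^ 2 →
      winJ M υ a ≠ 0 ∧ |Real.log ‖winJ M υ a‖ - farMain M υ (a / (υ : ℂ) ^ 2)| ≤ farLam υ / υ ^ 3 + 6 :=
  laplaceFar_of_wanted_v3 wanted_xi0_box wanted_saddle wanted_curvature wanted_descent wanted_connector wanted_value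

-- `stub_elementary`: PROVED in the tree (p448085 `Theorems/JensenPolynomialsFarGumbelElementary.lean`, eng-5 g3, namespace `…Theorems.JensenPolynomials.FarGumbel`, imported above) — the composition cites it by name.

-- `stub_cubicTransfer`: PROVED in the tree (p449503 `Theorems/JensenPolynomialsFarGumbelCubicTransferXi.lean`, eng-2 g2, namespace `…Theorems.JensenPolynomials.FarGumbel`, imported above) — the composition cites it by name.

/-! ## Composition (kernel-checked; no `sorry` below this line) -/

/-- The raw window polynomial at `s = 0` is `1`. -/
private lemma rawF_zero (M : ℕ) :
    (1 + ∑ k ∈ Finset.Icc 1 M, (((windowSeqDown xiTaylorCoeff M k / (Nat.factorial k : ℝ) : ℝ)) : ℂ) * (0 : ℂ) ^ k) = 1 := by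
  rw [Finset.sum_eq_zero]
  · simp
  · intro k hk
    have hk1 : k ≠ 0 := by have := (Finset.mem_Icc.mp hk).1; omega
    simp [zero_pow hk1]

/-- `farA M 0 = 0`. -/
private lemma farA_zero (M : ℕ) : farA M 0 = 0 := by
  simp [farA]

/-- `c_M > 0`. -/
private lemma cM_pos (M : ℕ) : 0 < cM M := div_pos (xiMoment_pos _) (xiMoment_pos _)

/-- `‖farA M s‖ = ‖s‖·c_M/(M−½)`. -/
private lemma norm_farA (M : ℕ) (hM : 1 ≤ M) (s : ℂ) :
    ‖farA M s‖ = ‖s‖ * cM M / ((M : ℝ) - 1 / 2) := by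
  have hM' : (0 : ℝ) < (M : ℝ) - 1 / 2 := by
    have : (1 : ℝ) ≤ M := by exact_mod_cast hM
    linarith
  unfold farA
  rw [norm_div, norm_mul, Complex.norm_real, Complex.norm_real, Real.norm_of_nonneg (cM_pos M).le,
    Real.norm_of_nonneg hM'.le]

/-- `farEnv > 0` for `‖z‖ < 1`. -/
private lemma farEnv_pos (M : ℕ) (υ : ℝ) (z : ℂ) (hz : ‖z‖ < 1) : 0 < farEnv M υ z := by
  unfold farEnv
  have h1 : 0 < ‖1 + z‖ := by
    have h := norm_sub_norm_le (1 : ℂ) (-z)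
    rw [sub_neg_eq_add, norm_neg, norm_one] at h
    linarith
  positivity

/-- **Composition, hypothesis form (sorry-free).** The six stub STATEMENTS imply the crux `XiWindowZeroFreeRelFar`. -/
theorem xiWindowZeroFreeRelFar_of_stubs
    (hmode : ∀ M : ℕ, 2 * 10 ^ 18 ≤ M → ∃ υ : ℝ,
        ((189 / 20 : ℝ) ≤ υ ∧ 4 * Real.pi * Real.exp (4 * υ) * υ = 2 * (M : ℝ) + 9 * υ))
    (hrepr : ∀ M : ℕ, 1 ≤ M → ∀ s : ℂ,
        (1 + ∑ k ∈ Finset.Icc 1 M, (((windowSeqDown xiTaylorCoeff M k / (Nat.factorial k : ℝ) : ℝ)) : ℂ) * s ^ k) *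
            ((xiMoment (2 * M) : ℝ) : ℂ) = winI M s)
    (hjunk : ∀ M : ℕ, 2 * 10 ^ 18 ≤ M → ∀ υ : ℝ,
        ((189 / 20 : ℝ) ≤ υ ∧ 4 * Real.pi * Real.exp (4 * υ) * υ = 2 * (M : ℝ) + 9 * υ) →
        ∀ s : ℂ, ‖s‖ ≤ (7 / 20 : ℝ) * M →
        ‖winI M s - winJ M υ (farA M s)‖ ≤ farEnv M υ (farA M s / (υ : ℂ) ^ 2))
    (hlap : ∀ M : ℕ, 2 * 10 ^ 18 ≤ M → ∀ υ : ℝ,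
        ((189 / 20 : ℝ) ≤ υ ∧ 4 * Real.pi * Real.exp (4 * υ) * υ = 2 * (M : ℝ) + 9 * υ) →
        ∀ a : ℂ, ‖a‖ ≤ (9 / 25 : ℝ) * υ ^ 2 →
        winJ M υ a ≠ 0 ∧ |Real.log ‖winJ M υ a‖ - farMain M υ (a / (υ : ℂ) ^ 2)| ≤ farLam υ / υ ^ 3 + 6)
    (helem : ∀ M : ℕ, 2 * 10 ^ 18 ≤ M → ∀ υ : ℝ,
        ((189 / 20 : ℝ) ≤ υ ∧ 4 * Real.pi * Real.exp (4 * υ) * υ = 2 * (M : ℝ) + 9 * υ) →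
        ∀ z : ℂ, ‖z‖ ≤ (3502 / 10000 : ℝ) →
        Real.log (farEnv M υ z) + 2 ≤ farMain M υ z - (farLam υ / υ ^ 3 + 6) ∧
        farMain M υ z - farMain M υ 0 - farCubic M υ z ≤ ((M : ℝ) - 1 / 2) / 150 + 1)
    (hcubic : ∀ M : ℕ, 2 * 10 ^ 18 ≤ M → ∀ υ : ℝ,
        ((189 / 20 : ℝ) ≤ υ ∧ 4 * Real.pi * Real.exp (4 * υ) * υ = 2 * (M : ℝ) + 9 * υ) →
        cM M ≤ (1 + 1 / 4000) * υ ^ 2 ∧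
        ∀ s : ℂ, ‖s‖ ≤ (7 / 20 : ℝ) * M →
          |farCubic M υ (farA M s / (υ : ℂ) ^ 2) -
            (s - ((gorttwDeltaSq xiTaylorCoeff M : ℝ) : ℂ) * s ^ 2 + ((gorttwU3 xiTaylorCoeff M : ℝ) : ℂ) * s ^ 3 / 6).re| ≤ (M : ℝ) / 1200 ∧
          (M : ℝ) / 118 ≤ 1 * (8 / 3) * (7 / 20 : ℝ) ^ 4 * (M : ℝ) ^ 3 * (gorttwDeltaSq xiTaylorCoeff M) ^ 2) :
    Summit.RiemannHypothesis.RiemannHypothesis.Theses.JensenPolynomials.XiWindowZeroFreeRelFar := by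
  intro M hM s hs
  have hM1 : 1 ≤ M := le_trans (by norm_num) hM
  have hMr : (2 * 10 ^ 18 : ℝ) ≤ (M : ℝ) := by exact_mod_cast hM
  have hM' : (0 : ℝ) < (M : ℝ) - 1 / 2 := by linarith only [hMr]
  have h0M : (0 : ℝ) ≤ M := by positivity
  -- the far mode
  obtain ⟨υ, hυ⟩ := hmode M hM
  have hυ0 : (189 / 20 : ℝ) ≤ υ := hυ.1
  have hυpos : 0 < υ := by linarith only [hυ0]
  have hυ2pos : 0 < υ ^ 2 := by positivity
  -- the window laws / cubic transfer / allowance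
  obtain ⟨hcM, hcub⟩ := hcubic M hM υ hυ
  obtain ⟨htrans, hallow⟩ := hcub s hs
  -- size of `a` and of `z̃ = a/υ²`
  have hsc : ‖s‖ * cM M ≤ (7 / 20 : ℝ) * M * ((1 + 1 / 4000) * υ ^ 2) :=
    mul_le_mul hs hcM (cM_pos M).le (by positivity)
  have hx1 : 0 ≤ υ ^ 2 * ((M : ℝ) - 20) := mul_nonneg hυ2pos.le (by linarith only [hMr])
  have hx2 : 0 ≤ υ ^ 2 * ((M : ℝ) - 1600) := mul_nonneg hυ2pos.le (by linarith only [hMr])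
  have hA : ‖farA M s‖ ≤ (9 / 25 : ℝ) * υ ^ 2 := by
    rw [norm_farA M hM1 s, div_le_iff₀ hM']
    linarith only [hsc, hx1, hυ2pos.le]
  have hZ : ‖farA M s / (υ : ℂ) ^ 2‖ ≤ (3502 / 10000 : ℝ) := by
    rw [norm_div, norm_pow, Complex.norm_real, Real.norm_of_nonneg hυpos.le, div_le_iff₀ hυ2pos,
      norm_farA M hM1 s, div_le_iff₀ hM']
    linarith only [hsc, hx2, hυ2pos.le]
  have hZ1 : ‖farA M s / (υ : ℂ) ^ 2‖ < 1 := lt_of_le_of_lt hZ (by norm_num)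
  have hA0 : ‖(0 : ℂ)‖ ≤ (9 / 25 : ℝ) * υ ^ 2 := by rw [norm_zero]; positivity
  have hZ0 : ‖(0 : ℂ)‖ ≤ (3502 / 10000 : ℝ) := by rw [norm_zero]; norm_num
  have hs0 : ‖(0 : ℂ)‖ ≤ (7 / 20 : ℝ) * M := by rw [norm_zero]; positivity
  -- instantiate the stubs (before abbreviating)
  have hμ : 0 < xiMoment (2 * M) := xiMoment_pos _
  have hrep := hrepr M hM1 s
  have hrep0 := hrepr M hM1 0
  rw [rawF_zero, one_mul] at hrep0
  obtain ⟨hJne, hJlog⟩ := hlap M hM υ hυ (farA M s) hA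
  obtain ⟨hJ0ne, hJ0log⟩ := hlap M hM υ hυ 0 hA0
  rw [zero_div] at hJ0log
  have hIJ := hjunk M hM υ hυ s hs
  have hIJ0 := hjunk M hM υ hυ 0 hs0
  rw [farA_zero, zero_div] at hIJ0
  obtain ⟨henv, hprof⟩ := helem M hM υ hυ (farA M s / (υ : ℂ) ^ 2) hZ
  obtain ⟨henv0, -⟩ := helem M hM υ hυ 0 hZ0
  have hEpos : 0 < farEnv M υ (farA M s / (υ : ℂ) ^ 2) := farEnv_pos M υ _ hZ1
  have hE0pos : 0 < farEnv M υ 0 := farEnv_pos M υ 0 (by rw [norm_zero]; norm_num)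
  -- abbreviations
  set I : ℂ := winI M s with hIdef
  set I0 : ℂ := winI M 0 with hI0def
  set J : ℂ := winJ M υ (farA M s) with hJdef
  set J0 : ℂ := winJ M υ 0 with hJ0def
  set z : ℂ := farA M s / (υ : ℂ) ^ 2 with hzdef
  set μ : ℝ := xiMoment (2 * M) with hμdef
  clear_value I I0 J J0 z μ
  -- (1) `Env·e² ≤ |J|`, hence `2‖I − J‖ ≤ ‖J‖`; same at 0
  have hJpos : 0 < ‖J‖ := norm_pos_iff.mpr hJne
  have hJ0pos : 0 < ‖J0‖ := norm_pos_iff.mpr hJ0ne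
  have hlogJ : Real.log (farEnv M υ z) + 2 ≤ Real.log ‖J‖ := by
    have := (abs_le.mp hJlog).1; linarith only [this, henv]
  have hlogJ0 : Real.log (farEnv M υ 0) + 2 ≤ Real.log ‖J0‖ := by
    have := (abs_le.mp hJ0log).1; linarith only [this, henv0]
  have he2 : (2 : ℝ) ≤ Real.exp 2 := by
    have := Real.add_one_le_exp (2 : ℝ); linarith only [this]
  have hEnvJ : farEnv M υ z * 2 ≤ ‖J‖ := by
    have h1 : Real.exp (Real.log (farEnv M υ z) + 2) ≤ Real.exp (Real.log ‖J‖) := Real.exp_le_exp.mpr hlogJ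
    rw [Real.exp_add, Real.exp_log hEpos, Real.exp_log hJpos] at h1
    have h2 := mul_le_mul_of_nonneg_left he2 hEpos.le
    linarith only [h1, h2]
  have hEnvJ0 : farEnv M υ 0 * 2 ≤ ‖J0‖ := by
    have h1 : Real.exp (Real.log (farEnv M υ 0) + 2) ≤ Real.exp (Real.log ‖J0‖) := Real.exp_le_exp.mpr hlogJ0
    rw [Real.exp_add, Real.exp_log hE0pos, Real.exp_log hJ0pos] at h1
    have h2 := mul_le_mul_of_nonneg_left he2 hE0pos.le
    linarith only [h1, h2]
  have hIJ' : ‖I - J‖ * 2 ≤ ‖J‖ := by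
    have : ‖I - J‖ ≤ farEnv M υ z := hIJ
    linarith only [this, hEnvJ]
  have hIJ0' : ‖I0 - J0‖ * 2 ≤ ‖J0‖ := by
    have : ‖I0 - J0‖ ≤ farEnv M υ 0 := hIJ0
    linarith only [this, hEnvJ0]
  -- (2) `I ≠ 0` and the two norm comparisons
  have hIne : I ≠ 0 := by
    intro h0
    rw [h0, zero_sub, norm_neg] at hIJ'
    linarith only [hIJ', hJpos]
  have hIpos : 0 < ‖I‖ := norm_pos_iff.mpr hIne
  have hIup : ‖I‖ ≤ 2 * ‖J‖ := by
    have : ‖I‖ ≤ ‖J‖ + ‖I - J‖ := by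
      calc ‖I‖ = ‖J + (I - J)‖ := by rw [add_sub_cancel]
        _ ≤ ‖J‖ + ‖I - J‖ := norm_add_le _ _
    linarith only [this, hIJ', hJpos]
  have hI0low : ‖J0‖ ≤ 2 * ‖I0‖ := by
    have : ‖J0‖ ≤ ‖I0‖ + ‖I0 - J0‖ := by
      calc ‖J0‖ = ‖I0 - (I0 - J0)‖ := by rw [sub_sub_cancel]
        _ ≤ ‖I0‖ + ‖I0 - J0‖ := norm_sub_le _ _
    linarith only [this, hIJ0', norm_nonneg (I0 - J0)]
  have hlog2 : Real.log 2 ≤ 1 := by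
    have := Real.log_two_lt_d9; linarith only [this]
  have hlogI : Real.log ‖I‖ ≤ Real.log ‖J‖ + 1 := by
    have h := Real.log_le_log hIpos hIup
    rw [Real.log_mul (by norm_num) hJpos.ne'] at h
    linarith only [h, hlog2]
  have hI0μ : I0 = ((μ : ℝ) : ℂ) := hrep0.symm
  have hI0pos : 0 < ‖I0‖ := by rw [hI0μ, Complex.norm_real, Real.norm_of_nonneg hμ.le]; exact hμ
  have hlogI0 : Real.log ‖J0‖ - 1 ≤ Real.log ‖I0‖ := by
    have h := Real.log_le_log hJ0pos hI0low
    rw [Real.log_mul (by norm_num) hI0pos.ne'] at h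
    linarith only [h, hlog2]
  -- (3) `F = I/μ` and the norm of the exponential
  have hμC : ((μ : ℝ) : ℂ) ≠ 0 := by exact_mod_cast hμ.ne'
  have hF : (1 + ∑ k ∈ Finset.Icc 1 M, (((windowSeqDown xiTaylorCoeff M k / (Nat.factorial k : ℝ) : ℝ)) : ℂ) * s ^ k) = I / ((μ : ℝ) : ℂ) := eq_div_of_mul_eq hμC hrep
  have hFne : (1 + ∑ k ∈ Finset.Icc 1 M, (((windowSeqDown xiTaylorCoeff M k / (Nat.factorial k : ℝ) : ℝ)) : ℂ) * s ^ k) ≠ 0 := by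
    rw [hF]; exact div_ne_zero hIne hμC
  refine ⟨hFne, ?_⟩
  have hnormF : ‖(1 + ∑ k ∈ Finset.Icc 1 M, (((windowSeqDown xiTaylorCoeff M k / (Nat.factorial k : ℝ) : ℝ)) : ℂ) * s ^ k)‖ = ‖I‖ / μ := by
    rw [hF, norm_div, Complex.norm_real, Real.norm_of_nonneg hμ.le]
  have hμI0 : Real.log μ = Real.log ‖I0‖ := by
    rw [hI0μ, Complex.norm_real, Real.norm_of_nonneg hμ.le]
  have hlogF : Real.log ‖(1 + ∑ k ∈ Finset.Icc 1 M, (((windowSeqDown xiTaylorCoeff M k / (Nat.factorial k : ℝ) : ℝ)) : ℂ) * s ^ k) *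
        Complex.exp (-(s - ((gorttwDeltaSq xiTaylorCoeff M : ℝ) : ℂ) * s ^ 2 + ((gorttwU3 xiTaylorCoeff M : ℝ) : ℂ) * s ^ 3 / 6))‖ =
      Real.log ‖I‖ - Real.log ‖I0‖ - (s - ((gorttwDeltaSq xiTaylorCoeff M : ℝ) : ℂ) * s ^ 2 + ((gorttwU3 xiTaylorCoeff M : ℝ) : ℂ) * s ^ 3 / 6).re := by
    rw [norm_mul, Complex.norm_exp, hnormF, Real.log_mul (div_pos hIpos hμ).ne' (Real.exp_pos _).ne',
      Real.log_div hIpos.ne' hμ.ne', Real.log_exp, hμI0, Complex.neg_re]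
    ring
  rw [hlogF]
  -- (4) the budget: `Λε³ = Λ/υ³ ≤ M/15940 + 3/1000` from the mode equation `4πe^{4υ}υ = 2M + 9υ` (`υ⁴ ≥ 7974`)
  have hB : farLam υ / υ ^ 3 ≤ (M : ℝ) / 15940 + 3 / 1000 := by
    have hυ3 : (189 / 20 : ℝ) ^ 3 ≤ υ ^ 3 := by gcongr
    have hυ4 : (189 / 20 : ℝ) ^ 4 ≤ υ ^ 4 := by gcongr
    have hυ3pos : 0 < υ ^ 3 := by positivity
    have hP : farLam υ = (2 * (M : ℝ) + 9 * υ) / (4 * υ) := by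
      unfold farLam
      rw [eq_div_iff (by positivity)]
      have : Real.pi * Real.exp (4 * υ) * (4 * υ) = 4 * Real.pi * Real.exp (4 * υ) * υ := by ring
      rw [this]
      exact hυ.2
    rw [hP, div_div, div_le_iff₀ (by positivity)]
    have h1 := mul_le_mul_of_nonneg_left (show (31880 : ℝ) ≤ 4 * υ ^ 4 by linarith only [hυ4]) h0M
    have h2 := mul_le_mul_of_nonneg_left (show (9000 : ℝ) ≤ 12 * υ ^ 3 by linarith only [hυ3]) hυpos.le
    have e1 : ((M : ℝ) / 15940 + 3 / 1000) * (4 * υ * υ ^ 3) =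
        (M : ℝ) * (4 * υ ^ 4) / 15940 + υ * (12 * υ ^ 3) / 1000 := by ring
    rw [e1]
    linarith only [h1, h2]
  -- (5) assemble (all linear)
  have habs := abs_le.mp hJlog
  have habs0 := abs_le.mp hJ0log
  have htr := abs_le.mp htrans
  have hfin : Real.log ‖I‖ - Real.log ‖I0‖ - (s - ((gorttwDeltaSq xiTaylorCoeff M : ℝ) : ℂ) * s ^ 2 + ((gorttwU3 xiTaylorCoeff M : ℝ) : ℂ) * s ^ 3 / 6).re ≤ (M : ℝ) / 118 := by
    linarith only [habs.2, habs0.1, htr.2, hprof, hlogI, hlogI0, hB, hMr]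
  exact hfin.trans hallow

/-- **Composition.** The crux `XiWindowZeroFreeRelFar` BY NAME from the six declared stubs (the only `sorry`s of this
file are inside `stub_*`; `stub_integralRepr` is already proved by theory g7). -/
theorem XiWindowZeroFreeRelFar_of :
    Summit.RiemannHypothesis.RiemannHypothesis.Theses.JensenPolynomials.XiWindowZeroFreeRelFar :=
  xiWindowZeroFreeRelFar_of_stubs stub_farMode stub_integralRepr stub_junk stub_laplaceFar stub_elementary
    stub_cubicTransfer

end Summit.RiemannHypothesis.RiemannHypothesis.Cruxes.XiWindowZeroFreeRelFar.FarGumbel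

end
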